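import Literature.Computability.MetaComplexity.PolynomialModmCorrelation
import Literature.Computability.MetaComplexity.RazborovSmolenskyPoly
import Literature.Computability.MetaComplexity.SmolenskyCorrelation
import HarnessLib

/-!
# Guessing and eliminating `|x| mod 3` with few low-degree `𝔽₂`-polynomial bits
# (Watts–Kothari–Schaeffer–Tal 2019, Lemma 36, polynomial form with exponential error)

The two-sided, sharp-threshold corollary of the Viola–Wigderson exponential-sum bound
(`PolynomialModmCorrelation.lean`, `violaWigderson_cube_sum_bound` / `_exp_bound`): if
`g_1, …, g_w : {0,1}ⁿ → 𝔽₂` are polynomial functions of degree `≤ d`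
(`g_j ∈ Smolensky.lowDeg (ZMod 2) n d`) and `dec` is ANY decoder of the `w` bits into a residue, then

* `abs_card_modThree_guess_sub_le` — the number of inputs with `dec(g(x)) ≡ |x| (mod 3)` is
  `2ⁿ/3 ± 2^w (1 + 2ⁿ·exp(−(3/2)·n/4^(wd+1)))/3` (guessing the residue succeeds with probability
  `1/3 ± o(1)` at fixed `w, d`);
* `card_modThree_eliminate_le` — consequently `dec(g(x)) ≢ |x| (mod 3)` ("eliminating a residue")
  holds on at most `(2/3)·2ⁿ + 2^w(1 + 2ⁿ·exp(−(3/2)·n/4^(wd+1)))/3` inputs: the constant eliminator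
  is optimal up to the error term, and exact degree-`d` eliminators exist only for `n = O_w(4^{wd})`.

* `card_modThree_guess_circuit_le`, `card_modThree_eliminate_circuit_le` — the same for `w` circuits
  over `accBasis 2 = {¬, ∧, ∨, MOD₂}` (`AC⁰[2]`) of `acDepth ≤ h`, via the tree's multi-output
  Razborov–Smolensky approximation (`Smolensky.razborov_smolensky_multi`, degree `ℓ^h` off an
  exceptional set of size `≤ (Σ size)·2ⁿ/2^ℓ`); HONEST SCOPE: non-trivial only for size
  `2^{o((log n)^{1/h})}` (the `log n`-degree barrier of the exponential-sum method, Viola–Wigderson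
  §1.2.1) — polynomial-size `AC⁰[2]` needs the random self-reduction of WKST Lemmas 35–36 over trits,
  which is not formalised here (and does not transfer to the uniform Boolean cube).

This is the polynomial-level, bit-input form (with an exponentially small error, meaningful in the
regime `w·d ≲ log₄ n`) of Watts–Kothari–Schaeffer–Tal 2019, Lemma 36: "an `AC⁰[2]/rpoly` circuit of depth `d`
and size at most `exp(n^{1/(10d)})` solves 3 Output Mod 3 on a uniform distribution with probability
at most `1/3 + n^{−Ω(1)}`" and of its two-sided Corollary 37 "for all `i ∈ {0,1,2}`:
`1/3 − n^{−Ω(1)} ≤ Pr_x[C(x) − |x| ≡ i (mod 3)] ≤ 1/3 + n^{−Ω(1)}`" (there: trit inputs, via the random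
self-reduction of Lemma 35 and Smolensky's bound). The Smolensky-type dimension count of the tree (`SmolenskyCorrelation.lean`,
`Smolensky.modq_agreement_le`: agreement `≤ 2ⁿ⁻¹ + D·C(n,n/2)`) gives only the one-sided `1/2 + o(1)`
and cannot exclude exact eliminators; the present bound is two-sided because the characters of
`ℤ/3` are equidistributed against EVERY low-degree sign pattern.

Proof (as in Viola–Wigderson §2.3 / Grewal–Kumar 2024 Cor. 5.29's use of the characters of `ℤ/3`):
`[a ≡ s (3)] = (1 + ω^{s+2a} + ω^{2(s+2a)})/3` with `ω = e^{2πi/3}`; decompose over the `2^w`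
values `v` of `g(x)`; `[g(x) = v] = (1 − (−1)^{Π_j (g_j(x)+v_j+1)})/2` with
`Π_j (g_j + v_j + 1)` of degree `≤ wd` (Smolensky 1987, Lemma 1); apply the Viola–Wigderson bound with
`ζ ∈ {ω, ω²}`, for which `Re ζ^(2^D) = −1/2`. Everything is proved; no named facts.

## References

* A. Bene Watts, R. Kothari, L. Schaeffer, A. Tal, *Exponential separation between shallow quantum
  circuits and unbounded fan-in shallow classical circuits*, STOC 2019, arXiv:1906.08890, Problem 9,
  Lemmas 35–36 and Corollary 37 [WattsEtAl2019].
* E. Viola, A. Wigderson, *Norms, XOR lemmas, and lower bounds for polynomials and protocols*,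
  Theory of Computing 4 (2008), 137–168, Thm. 2.9 [ViolaWigderson2008].
* R. Smolensky, *Algebraic methods in the theory of lower bounds for Boolean circuit complexity*,
  STOC 1987, Lemma 1 [Smolensky1987].
-/

noncomputable section

namespace Literature.Computability.MetaComplexity

namespace GowersCube

open Finset Smolensky
open scoped ComplexConjugate

section ModThree

variable {n : ℕ}

/-- The primitive cube root of unity `ω = −1/2 + i√3/2`. [folklore] -/
def omega3 : ℂ := ⟨-1 / 2, Real.sqrt 3 / 2⟩

/-- `Re ω = −1/2`. [folklore] -/
private theorem omega3_re : omega3.re = -1 / 2 := rfl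

/-- `ω² = conj ω`. [folklore] -/
private theorem omega3_sq : omega3 ^ 2 = conj omega3 := by
  have h3 : Real.sqrt 3 * Real.sqrt 3 = 3 := Real.mul_self_sqrt (by norm_num)
  apply Complex.ext
  · simp only [pow_two, Complex.mul_re, omega3, Complex.conj_re]
    nlinarith [h3]
  · simp only [pow_two, Complex.mul_im, omega3, Complex.conj_im]
    ring

/-- `‖ω‖ = 1`. [folklore] -/
private theorem normSq_omega3 : Complex.normSq omega3 = 1 := by
  have h3 : Real.sqrt 3 * Real.sqrt 3 = 3 := Real.mul_self_sqrt (by norm_num)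
  rw [Complex.normSq_apply]
  simp only [omega3]
  nlinarith [h3]

/-- `‖ω‖ = 1`. [folklore] -/
private theorem norm_omega3 : ‖omega3‖ = 1 := by
  have := Complex.sq_norm omega3
  rw [normSq_omega3] at this
  nlinarith [norm_nonneg omega3, this]

/-- `ω³ = 1`. [folklore] -/
private theorem omega3_cube : omega3 ^ 3 = 1 := by
  rw [pow_succ, omega3_sq, ← Complex.normSq_eq_conj_mul_self, normSq_omega3, Complex.ofReal_one]

/-- `ω^t` only depends on `t mod 3`. [folklore] -/
private theorem omega3_pow_eq_pow_mod (t : ℕ) : omega3 ^ t = omega3 ^ (t % 3) := by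
  conv_lhs => rw [← Nat.div_add_mod t 3, pow_add, pow_mul, omega3_cube, one_pow, one_mul]

/-- `Re ω^t = −1/2` unless `3 ∣ t`. [folklore] -/
private theorem omega3_pow_re {t : ℕ} (ht : ¬ 3 ∣ t) : (omega3 ^ t).re = -1 / 2 := by
  rw [omega3_pow_eq_pow_mod]
  have h : t % 3 = 1 ∨ t % 3 = 2 := by omega
  rcases h with h | h
  · rw [h, pow_one, omega3_re]
  · rw [h, omega3_sq, Complex.conj_re, omega3_re]

/-- `1 + ω^t + ω^{2t} = 3·[3 ∣ t]` (orthogonality of the characters of `ℤ/3`). [folklore] -/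
private theorem indicator_three_dvd (t : ℕ) :
    (if 3 ∣ t then (1 : ℂ) else 0) = (1 + omega3 ^ t + omega3 ^ (2 * t)) / 3 := by
  have hsum : 1 + omega3 + omega3 ^ 2 = 0 := by
    rw [omega3_sq, add_assoc, Complex.add_conj, omega3_re]
    push_cast
    ring
  by_cases h : 3 ∣ t
  · rw [if_pos h]
    obtain ⟨q, rfl⟩ := h
    rw [show 2 * (3 * q) = 3 * (2 * q) by ring, pow_mul, pow_mul, omega3_cube, one_pow, one_pow]
    norm_num
  · rw [if_neg h, omega3_pow_eq_pow_mod t, omega3_pow_eq_pow_mod (2 * t)]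
    have h12 : (t % 3 = 1 ∧ 2 * t % 3 = 2) ∨ (t % 3 = 2 ∧ 2 * t % 3 = 1) := by omega
    rcases h12 with ⟨h1, h2⟩ | ⟨h1, h2⟩
    · rw [h1, h2, pow_one, hsum, zero_div]
    · rw [h1, h2, pow_one, show (1 : ℂ) + omega3 ^ 2 + omega3 = 1 + omega3 + omega3 ^ 2 by ring,
        hsum, zero_div]

/-- `3 ∣ s + 2a ↔ s ≡ a (mod 3)`. [folklore] -/
private theorem three_dvd_add_two_mul_iff (s a : ℕ) : 3 ∣ s + 2 * a ↔ a % 3 = s % 3 := by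
  omega

/-- `3 ∤ 2^k`. [folklore] -/
private theorem not_three_dvd_two_pow (k : ℕ) : ¬ 3 ∣ 2 ^ k := fun h => by
  have := Nat.Prime.dvd_of_dvd_pow Nat.prime_three h
  omega

variable {w : ℕ}

/-- In `𝔽₂`: `Π_j (t_j + v_j + 1) = [t = v]`. [folklore] -/
private theorem prod_add_add_one_eq (t v : Fin w → ZMod 2) :
    (∏ j, (t j + v j + 1)) = if t = v then 1 else 0 := by
  by_cases h : t = v
  · subst h
    rw [if_pos rfl]
    exact Finset.prod_eq_one fun j _ => by rw [CharTwo.add_self_eq_zero, zero_add]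
  · rw [if_neg h]
    obtain ⟨j, hj⟩ := Function.ne_iff.1 h
    refine Finset.prod_eq_zero (Finset.mem_univ j) ?_
    exact (by decide : ∀ a b : ZMod 2, a ≠ b → a + b + 1 = 0) _ _ hj

/-- The real/complex indicator of `[g(x) = v]` through the sign character of the `𝔽₂`-indicator:
`[t = v] = (1 − χ(Π_j (t_j + v_j + 1)))/2`. [folklore] -/
private theorem indicator_eq_signChar (t v : Fin w → ZMod 2) :
    (if t = v then (1 : ℂ) else 0) = (1 - signChar (∏ j, (t j + v j + 1))) / 2 := by
  rw [prod_add_add_one_eq]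
  by_cases h : t = v
  · rw [if_pos h, if_pos h, signChar_one]; norm_num
  · rw [if_neg h, if_neg h, signChar_zero]; norm_num

variable {d : ℕ} {g : Fin w → CubeFn (ZMod 2) n}

/-- The `𝔽₂`-indicator `x ↦ Π_j (g_j(x) + v_j + 1)` of `g(x) = v` has degree `≤ w·d`.
[cite: Smolensky1987, Lemma 1 (composing with a fan-in-w gate multiplies degrees by w)] -/
theorem indicatorPoly_mem_lowDeg (hg : ∀ j, g j ∈ lowDeg (ZMod 2) n d) (v : Fin w → ZMod 2) :
    (fun x => ∏ j, (g j x + v j + 1)) ∈ lowDeg (ZMod 2) n (w * d) := by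
  have hfac : ∀ j, (g j + fun _ => v j + 1) ∈ lowDeg (ZMod 2) n d := fun j => by
    refine Submodule.add_mem _ (hg j) ?_
    have : (fun _ : Fin n → Bool => v j + 1) = (v j + 1) • (1 : CubeFn (ZMod 2) n) := by
      funext x; simp
    rw [this]
    exact Submodule.smul_mem _ _ (one_mem_lowDeg d)
  have h := prod_mem_lowDeg (univ : Finset (Fin w)) (fun j _ => hfac j)
  rw [Finset.card_univ, Fintype.card_fin] at h
  convert h using 1
  funext x
  rw [Finset.prod_apply]
  exact Finset.prod_congr rfl fun j _ => by rw [Pi.add_apply, add_assoc]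

/-- The number of `true` coordinates. [folklore] -/
private def wt (x : Fin n → Bool) : ℕ := (univ.filter fun i => x i = true).card

/-- `‖Σ_x ζ^{|x|}‖ ≤ 1` when `Re ζ = −1/2`, `‖ζ‖ = 1` (the degree-0 case of the main bound:
`|1 + ζ| = 1`). [folklore] -/
private theorem norm_sum_pow_wt_le {ζ : ℂ} (hζ : ‖ζ‖ = 1) (hre : ζ.re = -1 / 2) :
    ‖∑ x : Fin n → Bool, ζ ^ wt x‖ ≤ 1 := by
  have h := violaWigderson_cube_sum_bound (n := n) (d := 0) (P := 0)
    (Submodule.zero_mem _) hζ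
  simp only [Pi.zero_apply, signChar_zero, one_mul, zero_add, pow_one, pow_zero, hre] at h
  norm_num at h
  -- h : ‖(∑ x, ζ ^ _) / 2 ^ n‖ ^ 2 ≤ (1/4) ^ n
  have h2 : ‖(∑ x : Fin n → Bool, ζ ^ wt x) / 2 ^ n‖ ≤ (1 / 2) ^ n := by
    have h' : ‖(∑ x : Fin n → Bool, ζ ^ wt x) / 2 ^ n‖ ^ 2 ≤ ((1 / 2) ^ n) ^ 2 := by
      rw [← pow_mul, mul_comm, pow_mul]
      norm_num
      exact h
    exact (pow_le_pow_iff_left₀ (norm_nonneg _) (by positivity) two_ne_zero).1 h'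
  rw [norm_div, Complex.norm_pow, Complex.norm_two, div_le_iff₀ (by positivity)] at h2
  simpa using h2

/-- The per-value character sum `S_v(ζ) = Σ_x [g(x) = v] ζ^{|x|}` is small:
`‖S_v‖ ≤ (1 + 2ⁿ e^{−(3/2)n/4^{wd+1}})/2` for `ζ ∈ {ω, ω²}`. [folklore] -/
private theorem norm_valueSum_le (hg : ∀ j, g j ∈ lowDeg (ZMod 2) n d) (v : Fin w → ZMod 2)
    {ζ : ℂ} (hζ : ‖ζ‖ = 1) (hre : ζ.re = -1 / 2) (hreD : (ζ ^ 2 ^ (w * d)).re = -1 / 2) :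
    ‖∑ x : Fin n → Bool, (if (fun j => g j x) = v then (1 : ℂ) else 0) * ζ ^ wt x‖ ≤
      (1 + 2 ^ n * Real.exp (-(3 / 2 * n / 4 ^ (w * d + 1)))) / 2 := by
  have hexp := violaWigderson_cube_exp_bound (indicatorPoly_mem_lowDeg hg v) hζ
  rw [hreD] at hexp
  have hsplit : (∑ x : Fin n → Bool, (if (fun j => g j x) = v then (1 : ℂ) else 0) * ζ ^ wt x) =
      ((∑ x : Fin n → Bool, ζ ^ wt x) -
        ∑ x : Fin n → Bool, signChar (∏ j, (g j x + v j + 1)) * ζ ^ wt x) / 2 := by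
    rw [← Finset.sum_sub_distrib, Finset.sum_div]
    refine Finset.sum_congr rfl fun x _ => ?_
    rw [indicator_eq_signChar]
    ring
  rw [hsplit, norm_div, Complex.norm_two]
  refine div_le_div_of_nonneg_right ((norm_sub_le _ _).trans (add_le_add (norm_sum_pow_wt_le hζ hre) ?_)) zero_le_two
  have h2n : (0 : ℝ) < 2 ^ n := by positivity
  have := hexp
  rw [norm_div, Complex.norm_pow, Complex.norm_two, div_le_iff₀ h2n,
    show (1 : ℝ) - -1 / 2 = 3 / 2 by norm_num, mul_comm] at this
  exact this

/-- Coefficient sums `Σ_x c(dec(g(x))) ζ^{|x|}` decompose over the `2^w` values of `g(x)`.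
[folklore] -/
private theorem norm_coeffSum_le (hg : ∀ j, g j ∈ lowDeg (ZMod 2) n d) (dec : (Fin w → ZMod 2) → ℕ)
    (c : ℕ → ℂ) (hc : ∀ a, ‖c a‖ ≤ 1)
    {ζ : ℂ} (hζ : ‖ζ‖ = 1) (hre : ζ.re = -1 / 2) (hreD : (ζ ^ 2 ^ (w * d)).re = -1 / 2) :
    ‖∑ x : Fin n → Bool, c (dec fun j => g j x) * ζ ^ wt x‖ ≤
      2 ^ w * ((1 + 2 ^ n * Real.exp (-(3 / 2 * n / 4 ^ (w * d + 1)))) / 2) := by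
  have hdec : ∀ x : Fin n → Bool, c (dec fun j => g j x) * ζ ^ wt x =
      ∑ v : Fin w → ZMod 2, c (dec v) * ((if (fun j => g j x) = v then (1 : ℂ) else 0) * ζ ^ wt x) := by
    intro x
    rw [Finset.sum_eq_single (fun j => g j x)]
    · simp
    · intro v _ hv; rw [if_neg (Ne.symm hv)]; simp
    · intro h; exact absurd (Finset.mem_univ _) h
  rw [Finset.sum_congr rfl fun x _ => hdec x, Finset.sum_comm]
  simp_rw [← Finset.mul_sum]
  calc ‖∑ v : Fin w → ZMod 2, c (dec v) *
          ∑ x : Fin n → Bool, (if (fun j => g j x) = v then (1 : ℂ) else 0) * ζ ^ wt x‖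
      ≤ ∑ v : Fin w → ZMod 2, ‖c (dec v) *
          ∑ x : Fin n → Bool, (if (fun j => g j x) = v then (1 : ℂ) else 0) * ζ ^ wt x‖ :=
        norm_sum_le _ _
    _ ≤ ∑ _v : Fin w → ZMod 2, (1 + 2 ^ n * Real.exp (-(3 / 2 * n / 4 ^ (w * d + 1)))) / 2 := by
        refine Finset.sum_le_sum fun v _ => ?_
        rw [norm_mul]
        calc _ ≤ 1 * ‖∑ x : Fin n → Bool, (if (fun j => g j x) = v then (1 : ℂ) else 0) * ζ ^ wt x‖ :=
              mul_le_mul_of_nonneg_right (hc _) (norm_nonneg _)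
          _ ≤ _ := by rw [one_mul]; exact norm_valueSum_le hg v hζ hre hreD
    _ = 2 ^ w * ((1 + 2 ^ n * Real.exp (-(3 / 2 * n / 4 ^ (w * d + 1)))) / 2) := by
        rw [Finset.sum_const, Finset.card_univ, Fintype.card_fun, ZMod.card, Fintype.card_fin,
          nsmul_eq_mul]
        push_cast
        ring

/-- **Guessing `|x| mod 3` from `w` low-degree bits is right on `2ⁿ/3 ± 2^w(1 + 2ⁿe^{−(3/2)n/4^{wd+1}})/3`
inputs** (polynomial form, on bits and with an exponential error term, of Watts–Kothari–Schaeffer–Tal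
2019 Lemma 36 "an AC⁰[2]/rpoly circuit … solves 3 Output Mod 3 … with probability at most
1/3 + n^{−Ω(1)}"; a corollary of Viola–Wigderson 2008 Thm. 2.9 by expanding `[a ≡ |x| (3)]` in the
characters of `ℤ/3`): for `g_1,…,g_w : {0,1}ⁿ → 𝔽₂` of degree `≤ d` and ANY decoder `dec`, the number
of `x` with `dec(g(x)) ≡ |x| (mod 3)` differs from `2ⁿ/3` by at most
`2^w (1 + 2ⁿ·exp(−(3/2)·n/4^(wd+1)))/3`.
[cite: WattsEtAl2019, Lemma 36 and Corollary 37 (polynomial form via ViolaWigderson2008 Thm 2.9)] -/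
theorem abs_card_modThree_guess_sub_le (hg : ∀ j, g j ∈ lowDeg (ZMod 2) n d)
    (dec : (Fin w → ZMod 2) → ℕ) :
    |((univ.filter fun x : Fin n → Bool =>
          dec (fun j => g j x) % 3 = (univ.filter fun i => x i = true).card % 3).card : ℝ) -
        2 ^ n / 3| ≤
      2 ^ w * (1 + 2 ^ n * Real.exp (-(3 / 2 * n / 4 ^ (w * d + 1)))) / 3 := by
  set E : ℝ := (1 + 2 ^ n * Real.exp (-(3 / 2 * n / 4 ^ (w * d + 1)))) / 2 with hE
  -- ζ = ω and ζ = ω² both satisfy the hypotheses of `norm_coeffSum_le`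
  have hD1 : (omega3 ^ 2 ^ (w * d)).re = -1 / 2 := omega3_pow_re (not_three_dvd_two_pow _)
  have hD2 : ((omega3 ^ 2) ^ 2 ^ (w * d)).re = -1 / 2 := by
    rw [← pow_mul, ← pow_succ']
    exact omega3_pow_re (not_three_dvd_two_pow _)
  have hre2 : (omega3 ^ 2).re = -1 / 2 := by rw [omega3_sq, Complex.conj_re, omega3_re]
  have hn2 : ‖omega3 ^ 2‖ = 1 := by rw [norm_pow, norm_omega3, one_pow]
  -- the count as a character sum
  have hcount : (((univ.filter fun x : Fin n → Bool =>
        dec (fun j => g j x) % 3 = (univ.filter fun i => x i = true).card % 3).card : ℝ) : ℂ) -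
        2 ^ n / 3 =
      ((∑ x : Fin n → Bool, omega3 ^ (2 * dec (fun j => g j x)) * omega3 ^ wt x) +
        ∑ x : Fin n → Bool, omega3 ^ (4 * dec (fun j => g j x)) * (omega3 ^ 2) ^ wt x) / 3 := by
    rw [Complex.ofReal_natCast, Finset.natCast_card_filter]
    have hx : ∀ x : Fin n → Bool,
        (if dec (fun j => g j x) % 3 = (univ.filter fun i => x i = true).card % 3 then (1 : ℂ) else 0) =
          (1 + omega3 ^ (2 * dec (fun j => g j x)) * omega3 ^ wt x +
            omega3 ^ (4 * dec (fun j => g j x)) * (omega3 ^ 2) ^ wt x) / 3 := by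
      intro x
      set a := dec (fun j => g j x) with ha
      have hiff := three_dvd_add_two_mul_iff (wt x) a
      have key := indicator_three_dvd (wt x + 2 * a)
      have halg : (1 + omega3 ^ (wt x + 2 * a) + omega3 ^ (2 * (wt x + 2 * a))) / 3 =
          (1 + omega3 ^ (2 * a) * omega3 ^ wt x + omega3 ^ (4 * a) * (omega3 ^ 2) ^ wt x) / 3 := by
        rw [show 2 * (wt x + 2 * a) = 4 * a + 2 * wt x by ring, pow_add, pow_add, pow_mul]
        ring
      change (if a % 3 = wt x % 3 then (1 : ℂ) else 0) = _
      rw [← halg, ← key]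
      by_cases hc : a % 3 = wt x % 3
      · rw [if_pos hc, if_pos (hiff.2 hc)]
      · rw [if_neg hc, if_neg (fun h => hc (hiff.1 h))]
    rw [Finset.sum_congr rfl fun x _ => hx x, ← Finset.sum_div, Finset.sum_add_distrib,
      Finset.sum_add_distrib, Finset.sum_const, Finset.card_univ, Fintype.card_fun, Fintype.card_bool,
      Fintype.card_fin, nsmul_eq_mul, mul_one]
    push_cast
    ring
  have hnorm : |((univ.filter fun x : Fin n → Bool =>
        dec (fun j => g j x) % 3 = (univ.filter fun i => x i = true).card % 3).card : ℝ) - 2 ^ n / 3| =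
      ‖(((univ.filter fun x : Fin n → Bool =>
        dec (fun j => g j x) % 3 = (univ.filter fun i => x i = true).card % 3).card : ℝ) : ℂ) -
        2 ^ n / 3‖ := by
    rw [← Real.norm_eq_abs, ← Complex.norm_real]
    push_cast
    rfl
  rw [hnorm, hcount, norm_div, Complex.norm_ofNat]
  have h1 := norm_coeffSum_le hg dec (fun a => omega3 ^ (2 * a))
    (fun a => by rw [norm_pow, norm_omega3, one_pow]) norm_omega3 omega3_re hD1
  have h2 := norm_coeffSum_le hg dec (fun a => omega3 ^ (4 * a))
    (fun a => by rw [norm_pow, norm_omega3, one_pow]) hn2 hre2 hD2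
  calc _ ≤ (‖∑ x : Fin n → Bool, omega3 ^ (2 * dec (fun j => g j x)) * omega3 ^ wt x‖ +
          ‖∑ x : Fin n → Bool, omega3 ^ (4 * dec (fun j => g j x)) * (omega3 ^ 2) ^ wt x‖) / 3 :=
        div_le_div_of_nonneg_right (norm_add_le _ _) (by norm_num)
    _ ≤ (2 ^ w * E + 2 ^ w * E) / 3 := div_le_div_of_nonneg_right (add_le_add h1 h2) (by norm_num)
    _ = _ := by rw [hE]; ring

/-- **Eliminating a residue of `|x| mod 3` with `w` low-degree bits succeeds on at most
`(2/3)·2ⁿ + 2^w(1 + 2ⁿe^{−(3/2)n/4^{wd+1}})/3` inputs** (two-sidedness of the previous bound: the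
trivial eliminator — a constant — is optimal up to the error term; in particular exact degree-`d`
eliminators exist only for `n = O_w(4^{wd})`); Watts et al. Cor. 37 is the printed two-sided form
"`1/3 − n^{−Ω(1)} ≤ Pr_x[C(x) − |x| ≡ i (mod 3)] ≤ 1/3 + n^{−Ω(1)}` for all `i`".
[cite: WattsEtAl2019, Corollary 37 (polynomial form via ViolaWigderson2008 Thm 2.9)] -/
theorem card_modThree_eliminate_le (hg : ∀ j, g j ∈ lowDeg (ZMod 2) n d)
    (dec : (Fin w → ZMod 2) → ℕ) :
    ((univ.filter fun x : Fin n → Bool =>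
          dec (fun j => g j x) % 3 ≠ (univ.filter fun i => x i = true).card % 3).card : ℝ) ≤
      2 * 2 ^ n / 3 + 2 ^ w * (1 + 2 ^ n * Real.exp (-(3 / 2 * n / 4 ^ (w * d + 1)))) / 3 := by
  have h := abs_card_modThree_guess_sub_le hg dec
  have hsplit := Finset.card_filter_add_card_filter_not
    (s := (univ : Finset (Fin n → Bool)))
    (fun x : Fin n → Bool => dec (fun j => g j x) % 3 = (univ.filter fun i => x i = true).card % 3)
  rw [Finset.card_univ, Fintype.card_fun, Fintype.card_bool, Fintype.card_fin] at hsplit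
  have hs : (((univ.filter fun x : Fin n → Bool =>
          dec (fun j => g j x) % 3 ≠ (univ.filter fun i => x i = true).card % 3).card : ℝ)) =
      2 ^ n - ((univ.filter fun x : Fin n → Bool =>
          dec (fun j => g j x) % 3 = (univ.filter fun i => x i = true).card % 3).card : ℝ) := by
    have := congrArg (fun m : ℕ => (m : ℝ)) hsplit
    push_cast at this
    linarith
  rw [hs]
  have := (abs_le.1 h).1
  linarith

/-! ### Circuit level: `AC⁰[2]` circuits via Razborov–Smolensky -/

open Literature.Computability.Complexity in
/-- Reading the `𝔽₂`-valued approximants back as bits agrees with the circuit outputs off the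
exceptional set. [folklore] -/
private theorem dec_bits_eq {w : ℕ} (C : Fin w → Circuit (Fin n)) (P : Fin w → CubeFn (ZMod 2) n)
    (dec : (Fin w → Bool) → ℕ) (x : Fin n → Bool)
    (hPE : ∀ j, P j x = Smolensky.bit 2 ((C j).eval x)) :
    dec (fun j => decide (P j x ≠ 0)) = dec (fun j => (C j).eval x) := by
  congr 1
  funext j
  rw [hPE j]
  cases (C j).eval x <;> decide

open Literature.Computability.Complexity in
/-- **Guessing `|x| mod 3` with `w` bits computed by `AC⁰[2]` circuits** (Watts–Kothari–Schaeffer–Tal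
2019, Lemma 36, for `{¬,∧,∨,MOD₂}`-circuits on bits, deterministic, with explicit error): for circuits
`C_1,…,C_w` over `accBasis 2` of `acDepth ≤ h`, any decoder, and any `ℓ ≥ 1`, the number of `x` with
`dec(C(x)) ≡ |x| (mod 3)` is at most
`2ⁿ/3 + 2^w(1 + 2ⁿ·exp(−(3/2)·n/4^(w·ℓ^h+1)))/3 + (Σ_j size C_j)·2ⁿ/2^ℓ`
(Razborov–Smolensky: each `C_j` agrees with a polynomial of degree `ℓ^h` off one exceptional set `E`,
`|E| ≤ (Σ size)·2ⁿ/2^ℓ`; then `abs_card_modThree_guess_sub_le`). SCOPE: non-trivial only for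
`w·ℓ^h ≲ log₄ n`, i.e. size `2^{o((log n)^{1/h})}` — the `log n`-degree barrier of the method
(Viola–Wigderson 2008, §1.2.1); polynomial-size `AC⁰[2]` is Watts et al. Lemmas 35–36 (not here).
[cite: WattsEtAl2019, Lemma 36 (AC⁰[2] circuits; polynomial method with ViolaWigderson2008 Thm 2.9)] -/
theorem card_modThree_guess_circuit_le {w h ℓ : ℕ} (C : Fin w → Circuit (Fin n))
    (hC : ∀ j, (C j).IsOver (accBasis 2)) (hd : ∀ j, (C j).acDepth ≤ h) (hℓ : 1 ≤ ℓ)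
    (dec : (Fin w → Bool) → ℕ) :
    ((univ.filter fun x : Fin n → Bool =>
          dec (fun j => (C j).eval x) % 3 = (univ.filter fun i => x i = true).card % 3).card : ℝ) ≤
      2 ^ n / 3 + 2 ^ w * (1 + 2 ^ n * Real.exp (-(3 / 2 * n / 4 ^ (w * ℓ ^ h + 1)))) / 3 +
        (∑ j, ((C j).size : ℝ)) * 2 ^ n / 2 ^ ℓ := by
  classical
  obtain ⟨P, E, hP, hE, hPE⟩ := Smolensky.razborov_smolensky_multi (p := 2) C hC hd hℓ
  have hP' : ∀ j, P j ∈ lowDeg (ZMod 2) n (ℓ ^ h) := fun j => by simpa using hP j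
  set dec' : (Fin w → ZMod 2) → ℕ := fun v => dec fun j => decide (v j ≠ 0) with hdec'
  have hguess := abs_card_modThree_guess_sub_le hP' dec'
  have hsub : (univ.filter fun x : Fin n → Bool =>
        dec (fun j => (C j).eval x) % 3 = (univ.filter fun i => x i = true).card % 3) ⊆
      (univ.filter fun x : Fin n → Bool =>
        dec' (fun j => P j x) % 3 = (univ.filter fun i => x i = true).card % 3) ∪ E := by
    intro x hx
    rw [Finset.mem_union, Finset.mem_filter]
    by_cases hxE : x ∈ E
    · exact Or.inr hxE
    · refine Or.inl ⟨Finset.mem_univ _, ?_⟩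
      rw [hdec']
      beta_reduce
      rw [dec_bits_eq C P dec x (hPE x hxE)]
      exact (Finset.mem_filter.1 hx).2
  have hcard := (Finset.card_le_card hsub).trans (Finset.card_union_le _ _)
  have hEr : (E.card : ℝ) ≤ (∑ j, ((C j).size : ℝ)) * 2 ^ n / 2 ^ ℓ := by
    rw [le_div_iff₀ (by positivity)]
    exact_mod_cast hE
  have h1 := (abs_le.1 hguess).2
  calc _ ≤ (((univ.filter fun x : Fin n → Bool =>
          dec' (fun j => P j x) % 3 = (univ.filter fun i => x i = true).card % 3).card : ℝ)) +
          E.card := by exact_mod_cast hcard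
    _ ≤ _ := by linarith

open Literature.Computability.Complexity in
/-- **Eliminating a residue of `|x| mod 3` with `AC⁰[2]` circuits**: under the same hypotheses the
number of `x` with `dec(C(x)) ≢ |x| (mod 3)` is at most
`(2/3)·2ⁿ + 2^w(1 + 2ⁿ·exp(−(3/2)·n/4^(w·ℓ^h+1)))/3 + (Σ_j size C_j)·2ⁿ/2^ℓ`. SCOPE: the bound is
non-trivial only when `w·ℓ^h ≲ log₄ n` while `2^ℓ ≫ Σ_j size C_j`, i.e. for circuits of size
`2^{o((log n)^{1/h})}` (sub-polynomial for `h ≥ 2`) — the `log n`-degree barrier of the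
exponential-sum method (Viola–Wigderson 2008, §1.2.1); for polynomial-size `AC⁰[2]` the printed route
to `2/3 + o(1)` is the random self-reduction of Watts et al. Lemmas 35–36, NOT formalised here.
[cite: WattsEtAl2019, Corollary 37 (AC⁰[2] circuits; polynomial method with ViolaWigderson2008 Thm 2.9)] -/
theorem card_modThree_eliminate_circuit_le {w h ℓ : ℕ} (C : Fin w → Circuit (Fin n))
    (hC : ∀ j, (C j).IsOver (accBasis 2)) (hd : ∀ j, (C j).acDepth ≤ h) (hℓ : 1 ≤ ℓ)
    (dec : (Fin w → Bool) → ℕ) :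
    ((univ.filter fun x : Fin n → Bool =>
          dec (fun j => (C j).eval x) % 3 ≠ (univ.filter fun i => x i = true).card % 3).card : ℝ) ≤
      2 * 2 ^ n / 3 + 2 ^ w * (1 + 2 ^ n * Real.exp (-(3 / 2 * n / 4 ^ (w * ℓ ^ h + 1)))) / 3 +
        (∑ j, ((C j).size : ℝ)) * 2 ^ n / 2 ^ ℓ := by
  classical
  obtain ⟨P, E, hP, hE, hPE⟩ := Smolensky.razborov_smolensky_multi (p := 2) C hC hd hℓ
  have hP' : ∀ j, P j ∈ lowDeg (ZMod 2) n (ℓ ^ h) := fun j => by simpa using hP j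
  set dec' : (Fin w → ZMod 2) → ℕ := fun v => dec fun j => decide (v j ≠ 0) with hdec'
  have helim := card_modThree_eliminate_le hP' dec'
  have hsub : (univ.filter fun x : Fin n → Bool =>
        dec (fun j => (C j).eval x) % 3 ≠ (univ.filter fun i => x i = true).card % 3) ⊆
      (univ.filter fun x : Fin n → Bool =>
        dec' (fun j => P j x) % 3 ≠ (univ.filter fun i => x i = true).card % 3) ∪ E := by
    intro x hx
    rw [Finset.mem_union, Finset.mem_filter]
    by_cases hxE : x ∈ E
    · exact Or.inr hxE
    · refine Or.inl ⟨Finset.mem_univ _, ?_⟩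
      rw [hdec']
      beta_reduce
      rw [dec_bits_eq C P dec x (hPE x hxE)]
      exact (Finset.mem_filter.1 hx).2
  have hcard := (Finset.card_le_card hsub).trans (Finset.card_union_le _ _)
  have hEr : (E.card : ℝ) ≤ (∑ j, ((C j).size : ℝ)) * 2 ^ n / 2 ^ ℓ := by
    rw [le_div_iff₀ (by positivity)]
    exact_mod_cast hE
  calc _ ≤ (((univ.filter fun x : Fin n → Bool =>
          dec' (fun j => P j x) % 3 ≠ (univ.filter fun i => x i = true).card % 3).card : ℝ)) +
          E.card := by exact_mod_cast hcard
    _ ≤ _ := by linarith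

end ModThree

end GowersCube

end Literature.Computability.MetaComplexity
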